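import Summits.PneNP.PneNP.Theorems.ExpanderLinearGeneratorsColumnTwoFinalPrep
import Summits.PneNP.PneNP.Theorems.ExpanderLinearGeneratorsColumnTwoExpanderMinor
import Summits.PneNP.PneNP.Theorems.ExpanderLinearGeneratorsColumnTwoWeakCore
import Summits.PneNP.PneNP.Theses.MatroidTseitin

/-!
# PneNP / MatroidTseitin — `ExpandingXorDepthFregeLB` at column weight two, unconditionally

Route `PneNP/MatroidTseitin`, crux stmt-PneNP-11426
(`Summit.PneNP.PneNP.Theses.MatroidTseitin.ExpandingXorDepthFregeLB`, Ben-Sasson–Wigderson for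
bounded-depth Frege / Krajíček's Problem 19.4.5 in structural form): for `ℓ`, `d`, `δ, c > 0` and
large `n`, every unsatisfiable `ℓ`-sparse system over `𝔽₂` in `n` unknowns whose rows form a
`(δn, c)`-boundary expander needs depth-`d` `textbookFrege` refutations of size `≥ 2^{n^ε}`. This
file proves the conclusion under ONE extra hypothesis — every variable occurs in at most two
equations (Tseitin formulas of graphs whose vertex sets up to `δn` have edge expansion `c`, any
WEAK rate `c > 0`; in print via Galesi–Itsykson–Riazanov–Sofronova's treewidth theorem) — by
routing, with the weak-rate machinery of `…ColumnTwoWeakCore` (Krivelevich's extraction under weak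
local sparsity) and `…ColumnTwoExpanderMinor` (Krivelevich–Sudakov clique minors at any rate):

1. an odd closed component `K` of the row graph has `|K| > δn`; inside it the extraction gives a
   core `U`, `|U| > δn`, which is a GLOBAL vertex expander of rate `1/(8ℓ²⌈1/c⌉Λ(Λ+1))`,
   `2^Λ > 2n`;
2. the engine gives a clique minor of order `nRows ⌊n^{1/5}⌋` in `U` (budget
   `O_{ℓ,c}(Λ^{11} n^{4/5}) ≤ δ n`, `eventually_weak_budget`);
3. routing onto the grid Tseitin system of the bijective pigeonhole principle and the grid lower
   bound finish as in `…ColumnTwoFinal`.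

* `expandingXorDepthFregeLB_of_colWeight_le_two` — the slice.

References: N. Galesi, D. Itsykson, A. Riazanov, A. Sofronova, *Bounded-depth Frege complexity of
Tseitin formulas for all graphs*, MFCS 2019 / APAL 174 (2023) (the treewidth form, for comparison);
E. Ben-Sasson, Comput. Complexity 11 (2002); M. Krivelevich, SIAM J. Discrete Math. 32 (2018);
M. Krivelevich, B. Sudakov, GAFA 19 (2009).
-/

namespace Summit.PneNP.PneNP.Theorems.ColumnTwo

set_option linter.dupNamespace false -- `Summit.PneNP.PneNP.…`: summit = sub-problem (D-0017)

open Filter Finset Literature.Computability.MetaComplexity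
open Literature.Computability.MetaComplexity.TextbookFrege
open Literature.Computability.Complexity (PropForm Clause CNF Literal)
open Literature.Computability.MetaComplexity.KrajicekRamsey (clauseOf)
open Summit.PneNP.PneNP.Theorems.GridRouting

/-! ### The budget is eventually affordable -/

/-- `C (4 log n)^{11} (2 n^{1/5})^4 + 2 ≤ δ n` eventually. [folklore] -/
theorem eventually_weak_budget (C δ : ℝ) (hδ : 0 < δ) :
    ∀ᶠ n : ℕ in atTop,
      C * (4 * Real.log n) ^ 11 * (2 * (n : ℝ) ^ ((1 : ℝ) / 5)) ^ 4 + 2 ≤ δ * n := by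
  set C' : ℝ := max C 1 with hC'
  have hC'1 : (1 : ℝ) ≤ C' := le_max_right _ _
  have hCC' : C ≤ C' := le_max_left _ _
  have h15 : (0 : ℝ) < (1 : ℝ) / 5 := by norm_num
  set c : ℝ := δ / (2 * (C' * 4 ^ 11 * 16)) with hc
  have hcpos : 0 < c := by positivity
  have h1 : ∀ᶠ x : ℝ in atTop, ‖Real.log x ^ (11 : ℝ)‖ ≤ c * ‖x ^ ((1 : ℝ) / 5)‖ :=
    (isLittleO_log_rpow_rpow_atTop 11 h15).def hcpos
  have h2 : ∀ᶠ x : ℝ in atTop, (4 : ℝ) ≤ δ * x :=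
    (tendsto_id.const_mul_atTop hδ).eventually_ge_atTop 4
  have h3 := (h1.and (h2.and (eventually_ge_atTop (1 : ℝ)))).natCast_atTop
  filter_upwards [h3] with n hn
  obtain ⟨hlog, h4, hn1⟩ := hn
  have hn0 : (0 : ℝ) ≤ n := Nat.cast_nonneg n
  have hl0 : 0 ≤ Real.log n := Real.log_nonneg hn1
  have e11 : Real.log n ^ (11 : ℝ) = Real.log n ^ 11 := by
    rw [← Real.rpow_natCast]; norm_num
  rw [Real.norm_of_nonneg (by positivity), Real.norm_of_nonneg (by positivity), e11] at hlog
  have hp0 : 0 ≤ (n : ℝ) ^ ((1 : ℝ) / 5) := by positivity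
  have e1 : ((n : ℝ) ^ ((1 : ℝ) / 5)) ^ 4 * (n : ℝ) ^ ((1 : ℝ) / 5) = (n : ℝ) := by
    rw [← Real.rpow_natCast, ← Real.rpow_mul hn0, ← Real.rpow_add' hn0 (by norm_num)]
    norm_num
  have hst : 0 ≤ (4 * Real.log n) ^ 11 * (2 * (n : ℝ) ^ ((1 : ℝ) / 5)) ^ 4 := by positivity
  have key : C' * (4 * Real.log n) ^ 11 * (2 * (n : ℝ) ^ ((1 : ℝ) / 5)) ^ 4 ≤ δ * n / 2 := by
    calc C' * (4 * Real.log n) ^ 11 * (2 * (n : ℝ) ^ ((1 : ℝ) / 5)) ^ 4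
        = (C' * 4 ^ 11 * 16) * Real.log n ^ 11 * ((n : ℝ) ^ ((1 : ℝ) / 5)) ^ 4 := by ring
      _ ≤ (C' * 4 ^ 11 * 16) * (c * (n : ℝ) ^ ((1 : ℝ) / 5)) * ((n : ℝ) ^ ((1 : ℝ) / 5)) ^ 4 := by
          gcongr
      _ = ((C' * 4 ^ 11 * 16) * c) * (((n : ℝ) ^ ((1 : ℝ) / 5)) ^ 4 * (n : ℝ) ^ ((1 : ℝ) / 5)) := by
          ring
      _ = δ * n / 2 := by
          have hprod : (C' * 4 ^ 11 * 16) * c = δ / 2 := by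
            rw [hc]; field_simp
          rw [hprod, e1]; ring
  have hC : C * (4 * Real.log n) ^ 11 * (2 * (n : ℝ) ^ ((1 : ℝ) / 5)) ^ 4 ≤
      C' * (4 * Real.log n) ^ 11 * (2 * (n : ℝ) ^ ((1 : ℝ) / 5)) ^ 4 := by
    rw [mul_assoc, mul_assoc]
    exact mul_le_mul_of_nonneg_right hCC' hst
  linarith

/-- **The eventual inequalities of the weak slice.** [folklore] -/
theorem eventually_weak_params (Cn : ℕ) {δ : ℝ} (hδ : 0 < δ) :
    ∀ᶠ n : ℕ in atTop, 3 ≤ n ∧ (3 : ℝ) ≤ (n : ℝ) ^ ((1 : ℝ) / 5) ∧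
      Cn * (Nat.log 2 (2 * n) + 1) ^ 11 * (⌊(n : ℝ) ^ ((1 : ℝ) / 5)⌋₊ + 3) ^ 4 + 1 ≤ ⌊δ * n⌋₊ := by
  have h15 : (0 : ℝ) < (1 : ℝ) / 5 := by norm_num
  have e1 := eventually_weak_budget (Cn : ℝ) δ hδ
  have e2 : ∀ᶠ n : ℕ in atTop, (3 : ℝ) ≤ (n : ℝ) ^ ((1 : ℝ) / 5) :=
    ((tendsto_rpow_atTop h15).comp tendsto_natCast_atTop_atTop).eventually_ge_atTop _
  filter_upwards [e1, e2, eventually_ge_atTop 3] with n h1 h2 h3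
  refine ⟨h3, h2, ?_⟩
  rw [Nat.le_floor_iff (by positivity)]
  have hΛ := natLog_le h3
  have hk : ((⌊(n : ℝ) ^ ((1 : ℝ) / 5)⌋₊ : ℕ) : ℝ) + 3 ≤ 2 * (n : ℝ) ^ ((1 : ℝ) / 5) := by
    have := Nat.floor_le (show (0 : ℝ) ≤ (n : ℝ) ^ ((1 : ℝ) / 5) by positivity)
    linarith
  have hΛ0 : (0 : ℝ) ≤ ((Nat.log 2 (2 * n) + 1 : ℕ) : ℝ) := Nat.cast_nonneg _
  push_cast
  calc (Cn : ℝ) * ((Nat.log 2 (2 * n) : ℝ) + 1) ^ 11 * ((⌊(n : ℝ) ^ ((1 : ℝ) / 5)⌋₊ : ℝ) + 3) ^ 4 + 1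
      ≤ (Cn : ℝ) * (4 * Real.log n) ^ 11 * (2 * (n : ℝ) ^ ((1 : ℝ) / 5)) ^ 4 + 2 := by
        have hCn : (0 : ℝ) ≤ Cn := Nat.cast_nonneg Cn
        have : ((Nat.log 2 (2 * n) : ℝ) + 1) ≤ 4 * Real.log n := by exact_mod_cast hΛ
        have h0 : (0 : ℝ) ≤ (Nat.log 2 (2 * n) : ℝ) + 1 := by positivity
        have h0' : (0 : ℝ) ≤ ((⌊(n : ℝ) ^ ((1 : ℝ) / 5)⌋₊ : ℕ) : ℝ) + 3 := by positivity
        gcongr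
        norm_num
    _ ≤ δ * n := h1

/-- The budget arithmetic of the weak slice: with `b ≤ 16(ℓ+1)²qΛ²`, `h = (1+b)M`,
`M ≤ (k+3)²`, `t₁ = 2bΛ`, `ℓ_b = 1 + h(2(t₁+6b)+2)`, the engine's budget `16 b (h ℓ_b)(1+2b)` is at
most `3840 · 16⁵ (ℓ+1)^{10} q⁵ · Λ^{11} (k+3)⁴`. [folklore] -/
theorem weak_budget_le {b Λ ℓ q h M k t₁ ℓb : ℕ} (hb1 : 1 ≤ b) (hΛ1 : 1 ≤ Λ)
    (hbΛ : b ≤ 16 * (ℓ + 1) ^ 2 * q * Λ ^ 2) (hh : h = (1 + b) * M) (hMk : M ≤ (k + 3) ^ 2)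
    (ht₁ : t₁ = 2 * b * Λ) (hℓb : ℓb = 1 + h * (2 * (t₁ + 6 * b) + 2)) :
    16 * b * (h * ℓb) * (1 + 2 * b) ≤ (3840 * 16 ^ 5 * (ℓ + 1) ^ 10 * q ^ 5) * Λ ^ 11 * (k + 3) ^ 4 := by
  have hℓbb : ℓb ≤ 20 * b * (1 + b) * (k + 3) ^ 2 * Λ := by
    have e1 : 1 * 1 ≤ b * Λ := Nat.mul_le_mul hb1 hΛ1
    have e2 : b ≤ b * Λ := Nat.le_mul_of_pos_right b hΛ1
    have h1 : 2 * (t₁ + 6 * b) + 2 ≤ 18 * b * Λ := by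
      rw [ht₁]
      calc 2 * (2 * b * Λ + 6 * b) + 2 = 4 * (b * Λ) + 12 * b + 2 := by ring
        _ ≤ 18 * (b * Λ) := by omega
        _ = 18 * b * Λ := by ring
    have h2 : h ≤ (1 + b) * (k + 3) ^ 2 :=
      calc h = (1 + b) * M := hh
        _ ≤ (1 + b) * (k + 3) ^ 2 := Nat.mul_le_mul (le_refl _) hMk
    have hy : 0 < b * (1 + b) * (k + 3) ^ 2 * Λ :=
      Nat.mul_pos (Nat.mul_pos (Nat.mul_pos (by omega) (by omega)) (by positivity)) (by omega)
    calc ℓb = 1 + h * (2 * (t₁ + 6 * b) + 2) := hℓb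
      _ ≤ 1 + ((1 + b) * (k + 3) ^ 2) * (18 * b * Λ) := by gcongr
      _ = 1 + 18 * (b * (1 + b) * (k + 3) ^ 2 * Λ) := by ring
      _ ≤ 20 * (b * (1 + b) * (k + 3) ^ 2 * Λ) := by omega
      _ = 20 * b * (1 + b) * (k + 3) ^ 2 * Λ := by ring
  have hb2 : (1 + b) ^ 2 ≤ 4 * b ^ 2 :=
    calc (1 + b) ^ 2 ≤ (2 * b) ^ 2 := Nat.pow_le_pow_left (by omega) 2
      _ = 4 * b ^ 2 := by ring
  have hb3 : 1 + 2 * b ≤ 3 * b := by omega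
  have hb5 : b ^ 5 ≤ (16 * (ℓ + 1) ^ 2 * q * Λ ^ 2) ^ 5 := Nat.pow_le_pow_left hbΛ 5
  have h2 : h ≤ (1 + b) * (k + 3) ^ 2 :=
    calc h = (1 + b) * M := hh
      _ ≤ (1 + b) * (k + 3) ^ 2 := Nat.mul_le_mul (le_refl _) hMk
  calc 16 * b * (h * ℓb) * (1 + 2 * b) = (16 * b * (1 + 2 * b) * h) * ℓb := by ring
    _ ≤ (16 * b * (1 + 2 * b) * ((1 + b) * (k + 3) ^ 2)) *
          (20 * b * (1 + b) * (k + 3) ^ 2 * Λ) := by gcongr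
    _ = 320 * (b ^ 2 * ((1 + b) ^ 2 * (1 + 2 * b))) * ((k + 3) ^ 4 * Λ) := by ring
    _ ≤ 320 * (b ^ 2 * ((4 * b ^ 2) * (3 * b))) * ((k + 3) ^ 4 * Λ) := by gcongr
    _ = 3840 * b ^ 5 * ((k + 3) ^ 4 * Λ) := by ring
    _ ≤ 3840 * (16 * (ℓ + 1) ^ 2 * q * Λ ^ 2) ^ 5 * ((k + 3) ^ 4 * Λ) := by gcongr
    _ = (3840 * 16 ^ 5 * (ℓ + 1) ^ 10 * q ^ 5) * Λ ^ 11 * (k + 3) ^ 4 := by ring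

/-! ### The slice -/

/-- **`ExpandingXorDepthFregeLB` at column weight `≤ 2`, unconditionally.** For every `ℓ`, depth
`d` and `δ, c > 0` there are `ε > 0` and `N` such that for `n ≥ N`, every system
`E : Fin m → LinEqMod 2 n` over `𝔽₂` in which every variable occurs in at most two equations,
which is `ℓ`-sparse, whose row supports form a `(δn, c)`-boundary expander and which is
unsolvable, has no depth-`d` `textbookFrege` proof of `¬(sumEncoding 1 E)` of size `< 2^(n^ε)`.
This is the crux `Summit.PneNP.PneNP.Theses.MatroidTseitin.ExpandingXorDepthFregeLB` restricted
by the one extra hypothesis `hcol` (the graph / Tseitin case, for every WEAK rate `c`); proved by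
Krivelevich's extraction under weak local sparsity, the any-rate Krivelevich–Sudakov clique
minor, and the routing reduction to the grid Tseitin system of the bijective pigeonhole principle
(no switching lemma, no treewidth). [Galesi–Itsykson–Riazanov–Sofronova 2019/2023 (treewidth
form); Ben-Sasson 2002; Krivelevich 2018; Krivelevich–Sudakov 2009] -/
theorem expandingXorDepthFregeLB_of_colWeight_le_two :
    ∀ (ℓ d : ℕ) (δ c : ℝ), 0 < δ → 0 < c → ∃ ε : ℝ, 0 < ε ∧ ∃ N : ℕ, ∀ n ≥ N,
      ∀ (m : ℕ) (E : Fin m → LinEqMod 2 n),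
      (∀ j : Fin n, (Finset.univ.filter fun i => j ∈ (E i).supp).card ≤ 2) →
      (∀ e, (E e).supp.card ≤ ℓ) →
      IsBoundaryExpander (fun e : Fin m => ((E e).supp).map Fin.valEmbedding) (δ * n) c →
      ¬ SystemSat E Finset.univ →
      ∀ π : List (PropForm ℕ),
        textbookFrege.IsDepthProofOf d π (PropForm.neg (PropForm.ofCNF (sumEncoding 1 E))) →
          (2 : ℝ) ^ ((n : ℝ) ^ ε) ≤ (proofSize π : ℝ) := by
  intro ℓ d δ c hδ hc
  -- a scale `δ' ≤ 1`, the rate `1/q`, and the constant of the budget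
  set δ' : ℝ := min δ 1 with hδ'
  have hδ'0 : 0 < δ' := lt_min hδ one_pos
  have hδ'δ : δ' ≤ δ := min_le_left _ _
  have hδ'1 : δ' ≤ 1 := min_le_right _ _
  set q : ℕ := ⌈1 / c⌉₊ with hq
  have hq1 : 1 ≤ q := Nat.one_le_ceil_iff.2 (by positivity)
  have hqc : 1 ≤ (q : ℝ) * c := by
    have h1 : 1 / c ≤ q := Nat.le_ceil _
    rw [div_le_iff₀ hc] at h1
    linarith
  clear_value q
  obtain ⟨Cn, hCn⟩ : ∃ C : ℕ, C = 3840 * 16 ^ 5 * (ℓ + 1) ^ 10 * q ^ 5 := ⟨_, rfl⟩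
  obtain ⟨ε₀, hε₀, K₁, hK₁⟩ := gridTseitin_depthFrege_lowerBound (d + 3 * 4 + 16)
  obtain ⟨N, hN⟩ := eventually_atTop.1
    ((eventually_params one_pos le_rfl hε₀ K₁ transferConst).and (eventually_weak_params Cn hδ'0))
  refine ⟨1 * ε₀ / 10, by positivity, N, ?_⟩
  intro n hn m E hcol hsparse hexp hunsat π hπ
  obtain ⟨⟨hn3, hvol0, hK₁k, h227, hT3, hk4, -⟩, -, hk3, hbudget⟩ := hN n hn
  have _ := hunsat
  classical
  -- parameters
  set kg : ℕ := ⌊(n : ℝ) ^ ((1 : ℝ) / 5)⌋₊ with hkg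
  set Λ : ℕ := Nat.log 2 (2 * n) + 1 with hΛ
  set Mg : ℕ := nRows kg with hMg
  set r : ℕ := ⌊δ' * n⌋₊ with hr
  obtain ⟨b, hb⟩ : ∃ b : ℕ, b = 8 * ((ℓ + 1) * q) * Λ * (Λ + 1) * (ℓ + 1) := ⟨_, rfl⟩
  obtain ⟨h, hh⟩ : ∃ h : ℕ, h = (1 + b) * Mg := ⟨_, rfl⟩
  obtain ⟨t₁, ht₁⟩ : ∃ t : ℕ, t = 2 * b * Λ := ⟨_, rfl⟩
  obtain ⟨ℓb, hℓb⟩ : ∃ l : ℕ, l = 1 + h * (2 * (t₁ + 6 * b) + 2) := ⟨_, rfl⟩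
  set S : Fin m → Finset ℕ := fun i => (E i).supp.map Fin.valEmbedding with hS
  -- basic facts
  have hfloor1 : ⌊(n : ℝ) ^ (1 : ℝ)⌋₊ = n := by rw [Real.rpow_one, Nat.floor_natCast]
  rw [hfloor1] at hvol0
  have hn1 : (1 : ℝ) ≤ n := by exact_mod_cast (show 1 ≤ n by omega)
  have hΛ1 : 1 ≤ Λ := by rw [hΛ]; omega
  have hb1 : 1 ≤ b := by
    rw [hb]
    have : 0 < 8 * ((ℓ + 1) * q) * Λ * (Λ + 1) * (ℓ + 1) := by positivity
    omega
  have hMg1 : 1 ≤ Mg := (nRows_bounds kg).2.2.2.1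
  have hMgk : Mg ≤ (kg + 3) ^ 2 := (nRows_bounds kg).1
  have hcw := coverDegree_le_two_of_col E hcol
  have hℓ' : ∀ i, (S i).card ≤ ℓ + 1 := fun i => by
    simp only [hS, Finset.card_map]; exact (hsparse i).trans (Nat.le_succ ℓ)
  have hrδ : (r : ℝ) ≤ δ * n := (Nat.floor_le (by positivity)).trans
    (mul_le_mul_of_nonneg_right hδ'δ (Nat.cast_nonneg n))
  have hr1 : 1 ≤ r := by
    have : Cn * Λ ^ 11 * (kg + 3) ^ 4 + 1 ≤ r := hbudget
    omega
  -- weak expansion in integers: `|W| ≤ q |∂W|` for `|W| ≤ r`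
  have hexpq : ∀ W : Finset (Fin m), W.card ≤ r → W.card ≤ q * (boundary S W).card := by
    intro W hW
    have h1 := hexp W ((Nat.cast_le.2 hW).trans hrδ)
    have h2 : (W.card : ℝ) ≤ q * ((boundary S W).card : ℝ) :=
      calc (W.card : ℝ) = (W.card : ℝ) * 1 := by ring
        _ ≤ (W.card : ℝ) * ((q : ℝ) * c) := mul_le_mul_of_nonneg_left hqc (Nat.cast_nonneg _)
        _ = (q : ℝ) * (c * (W.card : ℝ)) := by ring
        _ ≤ (q : ℝ) * ((boundary S W).card : ℝ) := mul_le_mul_of_nonneg_left h1 (Nat.cast_nonneg _)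
    exact_mod_cast h2
  -- weak local sparsity and positive degrees
  have hLS : ∀ W : Finset (Fin m), W.card ≤ r →
      2 * q * eIn S W + W.card ≤ q * ∑ k ∈ W, (S k).card := by
    intro W hW
    have h1 := sum_card_eq hcw W
    have h2 := hexpq W hW
    have h3 : q * ∑ k ∈ W, (S k).card = q * (boundary S W).card + 2 * q * eIn S W := by
      rw [h1]; ring
    rw [h3]
    omega
  have hdeg : ∀ k, 0 < (S k).card := by
    intro k
    have h1 := hexpq {k} (by simp; exact hr1)
    rw [Finset.card_singleton] at h1
    have h2 : 0 < (boundary S {k}).card := by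
      rcases Nat.eq_zero_or_pos (boundary S {k}).card with h | h
      · rw [h] at h1; simp at h1
      · exact h
    have h3 : boundary S {k} ⊆ S k := (boundary_subset_cover _).trans (by simp [cover])
    exact lt_of_lt_of_le h2 (Finset.card_le_card h3)
  have hdegE : ∀ i, 0 < (E i).supp.card := fun i => by
    have := hdeg i; rwa [Finset.card_map] at this
  have hm2n : m ≤ 2 * n := card_rows_le E hcol hdegE
  have hmΛ : m < 2 ^ Λ := lt_of_le_of_lt hm2n (Nat.lt_pow_succ_log_self one_lt_two (2 * n))
  clear_value Λ r
  -- the budget of the clique-minor engine: `16 b (h ℓb) (1 + 2b) ≤ Cn Λ^{11} (kg+3)^4`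
  have hbΛ : b ≤ 16 * (ℓ + 1) ^ 2 * q * Λ ^ 2 := by
    rw [hb]
    have : Λ + 1 ≤ 2 * Λ := by omega
    calc 8 * ((ℓ + 1) * q) * Λ * (Λ + 1) * (ℓ + 1) ≤ 8 * ((ℓ + 1) * q) * Λ * (2 * Λ) * (ℓ + 1) := by
          gcongr
      _ = 16 * (ℓ + 1) ^ 2 * q * Λ ^ 2 := by ring
  have hbud0 : 16 * b * (h * ℓb) * (1 + 2 * b) ≤ Cn * Λ ^ 11 * (kg + 3) ^ 4 := by
    rw [hCn]; exact weak_budget_le hb1 hΛ1 hbΛ hh hMgk ht₁ hℓb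
  -- the clique minors in the odd closed components
  have hemb : ∀ K : Finset (Fin m), K.Nonempty → IsConn S K → boundary S K = ∅ →
      ∑ i ∈ K, (E i).2 = 1 → ∃ T : Fin Mg → Finset (Fin m),
        (∀ a, T a ⊆ K ∧ IsConn S (T a) ∧ (T a).Nonempty) ∧ (∀ a b, a ≠ b → Disjoint (T a) (T b)) ∧
        (∀ a b, a ≠ b → ((gridSystem kg a).supp ∩ (gridSystem kg b).supp).Nonempty →
          ∃ i ∈ T a, ∃ j ∈ T b, (S i ∩ S j).Nonempty) := by
    intro K hKne _ hKb _
    -- `|K| > r`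
    have hKr : r < K.card := by
      by_contra hle
      push Not at hle
      have h1 := hexpq K hle
      rw [hKb, Finset.card_empty, mul_zero, Nat.le_zero, Finset.card_eq_zero] at h1
      exact hKne.ne_empty h1
    -- the weak core
    obtain ⟨U, hUK, i, hi2, hUr, htouch, hstop⟩ := exists_weak_core hcw hℓ' (by omega) hKb hKr
      (fun W _ hW => hLS W hW)
    have hiΛ : i + 1 ≤ Λ := by
      have h2 : 2 ^ i < 2 ^ Λ :=
        lt_of_le_of_lt (hi2.trans ((Finset.card_le_univ K).trans (by simp))) hmΛ
      exact Nat.succ_le_of_lt ((Nat.pow_lt_pow_iff_right (by norm_num)).1 h2)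
    have hexpU : ∀ W ⊆ U, 2 * W.card ≤ U.card → 1 * W.card ≤ b * (nbr S U W).card := by
      intro W hW h2W
      have h1 := weak_card_le_nbr hcw hℓ' (fun W _ hW => hLS W hW) hUK htouch hstop
        (fun k _ => hdeg k) hW h2W
      rw [one_mul]
      refine h1.trans (Nat.mul_le_mul_right _ ?_)
      rw [hb]
      have : i + 2 ≤ Λ + 1 := by omega
      gcongr
    have hUm : U.card < 2 ^ Λ := lt_of_le_of_lt ((Finset.card_le_univ U).trans (by simp)) hmΛ
    have ht₁' : (2 * b) ^ t₁ * U.card < (2 * b + 1) ^ t₁ := by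
      rw [ht₁]; exact linking_radius hb1 hUm
    have hbud : 16 * b * (h * ℓb) * (1 + 2 * b) ≤ 1 * 1 * U.card := by
      have : Cn * Λ ^ 11 * (kg + 3) ^ 4 + 1 ≤ r := hbudget
      rw [one_mul, one_mul]
      omega
    obtain ⟨T, hT1, hT2⟩ := exists_clique_minor_fin (S := S) (U := U) (N := U.card) (a := 1)
      (b := b) (h := h) (ℓ := ℓb) (t₁ := t₁) rfl le_rfl hb1 hb1 hexpU ht₁' (by rw [hℓb]) hbud
      (M := Mg) (by rw [hh, one_mul])
    refine ⟨T, fun a => ⟨(hT1 a).1.trans hUK, (hT1 a).2.1, ?_⟩, fun a b hab => (hT2 a b hab).1,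
      fun a b hab _ => (hT2 a b hab).2⟩
    rw [← Finset.card_pos, (hT1 a).2.2, hℓb]; omega
  -- the routing substitution and the transfer
  obtain ⟨σ, hZ, hT, hloc⟩ := exists_routing_subst E (gridSystem kg) (k₀ := 4) hcol
    (card_filter_mem_supp_gridSystem (k := kg)) (card_supp_gridSystem_le kg) (sum_gridSystem_snd kg) hemb
  obtain ⟨π', hπ', hsize⟩ := transfer_isDepthProofOf (sumEncoding 1 E) (sumEncoding 1 (gridSystem kg))
    σ (Zσ := 9 * 2 ^ 4) (Tσ := 3 * 4) (qq := 2 ^ 4) (k := 4) hZ (by norm_num) hT hπ hloc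
  -- the grid lower bound
  have hlb := hK₁ kg hK₁k π' hπ'
  -- the size of the transferred proof
  have hms := msum_gridClauses_le (k := kg)
  have hsz : proofSize π' ≤ transferConst * (144 * proofSize π + 224 * Mg + 3) ^ 3 := by
    refine hsize.trans ?_
    have h1 : transferLines (proofSize π) (proofSize π * (9 * 2 ^ 4) +
        msum ((sumEncoding 1 (gridSystem kg)).map clauseOf)) (2 ^ 4) 4 ≤
        transferLines (144 * proofSize π) (144 * proofSize π + 224 * Mg) 16 4 := by
      rw [show (2 ^ 4 : ℕ) = 16 by norm_num]
      exact transferLines_mono (by omega) (by omega)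
    have h2 : 40 * ((2 ^ 4 + 3) * (proofSize π * (9 * 2 ^ 4) +
        msum ((sumEncoding 1 (gridSystem kg)).map clauseOf) + 3) + 4) + 300 ≤
        40 * (19 * (144 * proofSize π + 224 * Mg + 3) + 4) + 300 := by
      norm_num
      omega
    exact (Nat.mul_le_mul h1 h2).trans (transferBound_le' (144 * proofSize π) Mg)
  -- conclude
  have hMn : Mg ≤ n := by
    have h2 : (kg + 3) ^ 2 ≤ (kg + 3) ^ 4 := Nat.pow_le_pow_right (by omega) (by norm_num)
    have hpos : 0 < 10 ^ 11 * Λ ^ 5 := Nat.mul_pos (Nat.pow_pos (by norm_num)) (Nat.pow_pos (by omega))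
    have h3 : (kg + 3) ^ 4 ≤ 10 ^ 11 * Λ ^ 5 * (kg + 3) ^ 4 := Nat.le_mul_of_pos_left _ hpos
    omega
  have hT0 : 0 < transferConst := by unfold transferConst; omega
  exact lb_arith hT0 hlb hsz hMn (by omega) h227 hT3 hk4

end Summit.PneNP.PneNP.Theorems.ColumnTwo
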